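import Summits.BirchSwinnertonDyer.BirchSwinnertonDyer.Theorems.QuadraticBranchSignedControlPlusKatoDivisibilityIotaOfNamedFactsContra
import Summits.BirchSwinnertonDyer.BirchSwinnertonDyer.Theorems.QuadraticBranchSignedControlEtaDescentFrame
import Summits.BirchSwinnertonDyer.BirchSwinnertonDyer.Theorems.QuadraticBranchSignedControlPlusKatoDivisibilityBranchOntoIotaOfNamedInputs
import Summits.BirchSwinnertonDyer.BirchSwinnertonDyer.Theorems.QuadraticBranchSignedControlPlusKatoDivisibilityBranchOntoOfIotaOfInvolInvariant
import Literature.NumberTheory.EllipticCurves.Kim2008.AlgebraicFunctionalEquationSigned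
import Literature.NumberTheory.EllipticCurves.CyclotomicZpExtension
import HarnessLib

/-!
# K8 support item `PlusSignedDualsInvolInvariant` (stmt-BirchSwinnertonDyer-26766) BY NAME: the algebraic functional
# equation of BOTH signed duals on the K8 rows from B. D. Kim 2008 (Thm. 3.12 / Thm. 3.11, typed p615855) + Kobayashi
# Thm. 1.2 / 2.2, through the PROVED prime-to-`p` descent frame — and the literal crux 20445 from print-named facts only

Cell `bsd-potss` (HOME `run/shared/lean/pub/bsd-potss/`), seat `bsd-potss-k8q-c2x` g11 (prover; lane B of the K8 Kato side,
route `QuadraticBranchSignedControl`), wake W8 of `k8q-c2x/WAKE-k8q-c2x.md` §7 (planner g27 INBOX 2026-08-28T08:15:13Z).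
HONEST FRAMING: THEOREMS ONLY — no definition, no named fact, no instance, no `sorry`; CONDITIONAL on the displayed named
Literature facts `h12` = `Kobayashi2003.thm12_signedSelmerDual_finite_torsion`, `h22` =
`Kobayashi2003.thm22_etaSignedSelmerDual_finite_torsion`, `h312` = `Kim2008.thm312_signedSelmerDual_charIdeal_map_invol`,
`h311` = `Kim2008.thm311_etaSignedSelmerDual_charIdeal_map_invol` (and, in §6, `hZ′`, `Q73′`); nothing of Kim / Kobayashi /
Kato is proved here; closes no item by itself (the item's own signature is the bare statement); BSD is proved for no curve.

## What

The item (child 2 of the literal K8 crux 20445 `PlusKatoDivisibilityBranchOnto`) displays, on the K8 rows (`V/ℚ` globally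
minimal, `p ≥ 5` good with `a_p = 0`, `F` quadratic with `θ² = p*`, `V' = C • V_F`, cyclotomic `(κ, γ)` over `ℚ` and `(κF, γF)`
over `F`, ARBITRARY topological generators), the `ι`-invariance of the two plus characteristic ideals:
`D.charIdeal.map ι = D.charIdeal` (`D` a dual datum of `Sel⁺(V/ℚ_∞)` at `γ`) and `DF.charIdeal.map ι = DF.charIdeal` (`DF` a
dual datum of `Sel⁺(V'/F_∞)` at `γF`), `ι = IwasawaAlgebra.invol p`.

* The `D`-half is Kim Thm. 3.12 at `K = ℚ` BY NAME (`Kim2008.thm312_….plus_of_five_le`, typer bsd-stepL-defn-ty1 g19).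
* The `DF`-half is NOT in print as such (`p` ramifies in `F`): it is the `{1, η_F}`-part of Kim Thm. 3.11 over `ℚ(μ_{p^∞})`
  after prime-to-`p` descent. THIS FILE does that descent in the kernel, with no unprinted statement:
  §1 `etaDescentFrame_of_inv_mul_resGal_mem` — the PROVED descent frame `etaDescentFrame_proof` (item 19611; k8q-c3's layer
  comparison `etaLayerComparison_proof`, item 19583) re-assembled from its landed bricks with the two `ζ`-normalisation clauses
  (`IsCyclotomicVariable p γ`, `χ_F(γF)·ζ = 1 + p`) replaced by what they are used for, `γ⁻¹·γF|_{ℚ̄} ∈ ker κ`; hence the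
  decomposition `Sel⁺(V'/F_∞) ≃+ Sel⁺(V/ℚ_∞) × Sel⁺(V/ℚ(μ_{p^∞}))^{η_F}` intertwining `conj_{γF}` with `conj_γ` for EVERY
  topological generator `γF` of EVERY cyclotomic `κF` — §2 `exists_rat_frame_of_isTopGenerator` builds the matching cyclotomic
  `(κ, γ)` over `ℚ` (`κ = u • κ_cyc` with `κ(γF|) = 1`, `γ ∈ Gal(ℚ̄/ℚ(μ_p))`, `γ⁻¹·γF| ∈ ker κ`), so no change of variable
  `T ↦ (1+T)^a − 1` is ever needed;
  §3 `exists_etaDatum_prod_linearEquiv_of_frame` — `DF.X ≃ₗ[Λ] D.X × Dη.X` (product dual datum + uniqueness of signed dual data;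
  k8q-c2's decomposition lemma made frame-pointwise);
  §4 `charIdeal_map_invol_eq_DF_of_namedFacts` — `Char DF = Char D · Char Dη` (multiplicativity needs finitely generated torsion:
  Thm. 1.2 for `D`, Thm. 2.2 at `η_F` for `Dη`), then Kim 3.12 on `D` and Kim 3.11 on the `η_F`-component `Dη` (`η_F² = 1`).
* §5 `plusSignedDualsInvolInvariant_of_namedFacts : h12 → h22 → h312 → h311 → PlusSignedDualsInvolInvariant` — the item's route
  decl VERBATIM as conclusion (glue-ready: the planner may resplit 26766 into the four held aliases + this glue).
* §6 `plusKatoDivisibilityBranchOnto_of_printNamedFacts : h12 → hZ′ → Q73′ → h22 → h312 → h311 → PlusKatoDivisibilityBranchOnto` —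
  the LITERAL crux 20445 from six print-exact named Literature facts, through the closed gen-2 children 26765 (p614428) and glue
  26770 (p614470).

References: [KimBD2008MRL] Thm. 3.11, Thm. 3.12 (p. 93), p. 84 (η-decomposition, `p ∤ |Δ|`), §1 eq. (1) p. 83;
[Kobayashi2003] Def. 1.1 (p. 2), Thm. 1.2 (p. 2), Def. 2.1 / Thm. 2.2 (p. 5), §3 p. 5 (`γ ↔ 1 + X`, `G_∞ = Δ × Γ`), §4 p. 8;
[GreenbergLNM1716] §3 (descent in prime-to-`p` extensions); [Washington1997] §13.1 (the cyclotomic `ℤ_p`-extension is unique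
up to `ℤ_pˣ`), §13.2 (characteristic ideals).
-/

set_option autoImplicit false
-- justification: the `Summit.BirchSwinnertonDyer.BirchSwinnertonDyer.…` path repeats a component (route-file convention)
set_option linter.dupNamespace false

noncomputable section

open scoped Classical

namespace Summit.BirchSwinnertonDyer.BirchSwinnertonDyer.Theorems

namespace SignedDualsInvol

open Field WeierstrassCurve
open Literature.NumberTheory.EllipticCurves
open Literature.NumberTheory.GaloisRepresentations
open Summit.BirchSwinnertonDyer.Rank1Residual.Additive
open Summit.BirchSwinnertonDyer.Rank1Residual.Additive.SignedTwist
open Summit.BirchSwinnertonDyer.Rank1Residual.AdditivePotMult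
open Summit.BirchSwinnertonDyer.BirchSwinnertonDyer.Theses.QuadraticBranchSignedControl

/-! ## §1 The descent frame with the `ζ`-clauses replaced by `γ⁻¹·γF|_{ℚ̄} ∈ ker κ` -/

/-- **The prime-to-`p` descent frame, δ-form.** For `p ≥ 5`, `K₀ ⊇ ℚ(ζ_p)` cyclotomic with an even non-trivial sign character
`ηq`, a good `a_p = 0` curve `V/ℚ`, a cyclotomic `κ` with a topological generator `γ ∈ Gal(ℚ̄/K₀)`, a quadratic model
`(F ∋ θ, θ² = p*, V' = C • V_F)`, a cyclotomic `κF` over `F` with a topological generator `γF`, and `γ⁻¹·γF|_{ℚ̄} ∈ ker κ`: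
a decomposition `Φ : Sel⁺(V'/F_∞) ≃+ Sel⁺(V/ℚ_∞) × Sel⁺(V/K₀ℚ_∞)^η` intertwining `conj_{γF}` with `conj_γ`. This is
`etaDescentFrame_proof` (item 19611) with its first step removed: there the two `ζ`-clauses (`γ ↔ 1 + X`, `χ_F(γF)·ζ = 1 + p`)
serve only to produce `hδ` (`inv_mul_resGal_mem_kerSubgroup_of_zeta`); everything after — `κF = κ|_{Γ_F}`
(`eq_restrictGal_of_isTopGenerator`), k8q-c3's PROVED comparison `selmerComparison_of_map_eq (selmerMap_of_layerMaps
etaLayerComparison_proof)` (items 19583/19585), the model change `EtaFrame.exists_addEquiv_signedSelmerInfty_of_model` and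
`etaDecomposition_of_model` — consumes `hδ` only. UNCONDITIONAL.
[cite: Kobayashi2003, Def. 1.1 (p. 2), Def. 2.1 (p. 5), §3 p. 5, §4 p. 8] [cite: GreenbergLNM1716, §3]
[cite: Washington1997, §13.1] -/
theorem etaDescentFrame_of_inv_mul_resGal_mem (p : ℕ) [Fact p.Prime] (hp5 : 5 ≤ p)
    (K₀ : Type) [Field K₀] [NumberField K₀] [IsCyclotomicExtension {p} ℚ K₀]
    [(galRange (K := ℚ) K₀).Normal] (ηq : absoluteGaloisGroup ℚ →* ℤˣ)
    (hηK : ∀ σ ∈ galRange (K := ℚ) K₀, ηq σ = 1) (hη1 : ηq ≠ 1)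
    (V : WeierstrassCurve ℚ) [V.IsElliptic] [V.IsGloballyMinimal]
    (hgood : V.HasGoodReductionAtPrime p) (hap : V.frobeniusTrace p = 0)
    (κ : ZpExtension ℚ p) (γ : absoluteGaloisGroup ℚ) (hκ : κ.IsCyclotomic) (hγ : κ.IsTopGenerator γ)
    (hγK : γ ∈ galRange (K := ℚ) K₀)
    (F : Type) [Field F] [NumberField F] (V' : WeierstrassCurve F) [V'.IsElliptic]
    (κF : ZpExtension F p) (γF : absoluteGaloisGroup F)
    (h2 : Module.finrank ℚ F = 2) (hθ : ∃ θ : F, θ ^ 2 = algebraMap ℚ F ((-1) ^ (p / 2) * p))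
    (hCV' : ∃ C : VariableChange F, C • V.baseChange F = V')
    (hκF : κF.IsCyclotomic) (hγF : κF.IsTopGenerator γF)
    (hδ : γ⁻¹ * resGal (K := ℚ) F γF ∈ κ.kerSubgroup) :
    ∃ Φ : Kobayashi2003.signedSelmerInfty V' κF 1 ≃+
        Kobayashi2003.signedSelmerInfty V κ 1 × towerSignedSelmerInftyEta V κ K₀ ℚ_[p] ηq 1,
      ∀ s : Kobayashi2003.signedSelmerInfty V' κF 1,
        ((Φ ⟨V'.conjH1 p κF.kerSubgroup γF s,
            Kobayashi2003.conjH1_mem_signedSelmerInfty V' κF 1 γF s.2⟩).1 : V.subgroupH1 p κ.kerSubgroup) =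
          V.conjH1 p κ.kerSubgroup γ (Φ s).1 ∧
        ((Φ ⟨V'.conjH1 p κF.kerSubgroup γF s,
            Kobayashi2003.conjH1_mem_signedSelmerInfty V' κF 1 γF s.2⟩).2 :
            V.subgroupH1 p (towerTopSubgroup κ K₀)) =
          V.conjH1 p (towerTopSubgroup κ K₀) γ (Φ s).2 := by
  -- adapted from seat k8eta-c2's `etaDescentFrame_proof` (…EtaDescentFrame.lean §4), first step (ζ ⟹ δ) removed
  have hpP : p.Prime := Fact.out
  have hp2 : p ≠ 2 := by omega
  obtain ⟨θF, hcF⟩ := hθ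
  have hθF : θF ∉ Set.range (algebraMap ℚ F) := by
    rintro ⟨q, hq⟩
    apply forall_sq_ne_pStar p q
    apply (algebraMap ℚ F).injective
    rw [map_pow, hq, hcF]
  haveI : IsGalois ℚ F := isGalois_of_finrank_eq_two F h2
  haveI hN : (galRange (K := ℚ) F).Normal := RelModel.normal_galRange (K := ℚ) F
  have hcop : p.Coprime (Module.finrank ℚ F) := by
    rw [h2]; exact (Nat.coprime_primes hpP Nat.prime_two).mpr hp2
  have hκ₀ : ∀ x, ∃ g ∈ galRange (K := ℚ) F, κ g = x :=
    kappa_surjOn_galRange_of_coprime_finrank κ F hcop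
  -- `κF = κ|_{Γ_F}` on the nose
  obtain rfl : κF = BaseChange.restrictGal F κ hκ₀ :=
    eq_restrictGal_of_isTopGenerator F hκ hκ₀ hγ hκF hγF hδ
  -- k8q-c3's comparison at `(V_F, κ|_{Γ_F}, γF)`
  obtain ⟨ΨA₀, hΨA₀⟩ := selmerComparison_of_map_eq
    (selmerMap_of_layerMaps (by
      have hL := etaLayerComparison_proof
      unfold Theses.QuadraticBranchSignedControl.EtaLayerComparison at hL
      exact hL))
    p hp5 V hgood hap κ hκ F θF h2 hθF hcF hκ₀ γF hγF
  -- the model change `V' = C • V_F`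
  obtain ⟨C, hC⟩ := hCV'
  obtain ⟨ΨC, -, hΨC⟩ := EtaFrame.exists_addEquiv_signedSelmerInfty_of_model p hC
    (BaseChange.restrictGal F κ hκ₀) 1
  -- assemble
  refine etaDecomposition_of_model p hp2 K₀ ηq hηK hη1 V κ γ hκ hγK F θF V'
    (BaseChange.restrictGal F κ hκ₀) γF (ΨC.trans ΨA₀) h2 hθF hcF hδ fun s => ?_
  rw [AddEquiv.trans_apply, AddEquiv.trans_apply]
  have h1 : ΨC ⟨V'.conjH1 p (BaseChange.restrictGal F κ hκ₀).kerSubgroup γF s,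
      Kobayashi2003.conjH1_mem_signedSelmerInfty V' _ 1 γF s.2⟩ =
      ⟨(V.baseChange F).conjH1 p (BaseChange.restrictGal F κ hκ₀).kerSubgroup γF (ΨC s),
        Kobayashi2003.conjH1_mem_signedSelmerInfty (V.baseChange F) _ 1 γF (ΨC s).2⟩ :=
    Subtype.ext (hΨC γF s)
  rw [h1]
  exact hΨA₀ (ΨC s)

/-! ## §2 A cyclotomic frame over `ℚ` matching an ARBITRARY topological generator over `F` -/

/-- **Every `(κF, γF)` — `κF` cyclotomic over the quadratic field `F`, `γF` any topological generator — is matched by a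
cyclotomic `(κ, γ)` over `ℚ` with `γ ∈ Gal(ℚ̄/K₀)` and `γ⁻¹·γF|_{ℚ̄} ∈ ker κ`.** Take the cyclotomic tower `κ_cyc` of `ℚ`
(`CyclotomicZp.zpExtension`); its restriction to `Γ_F` is cyclotomic, so `κF = (κ_cyc|_{Γ_F})·u` for a unit `u` (uniqueness of
the cyclotomic `ℤ_p`-extension up to `ℤ_pˣ`); then `κ := κ_cyc·u` is cyclotomic (same kernel) with `κ(γF|_{ℚ̄}) = κF(γF) = 1`,
and `γ ∈ Gal(ℚ̄/K₀)` with `κ γ = κ(γF|)` exists because `κ` is onto on `Gal(ℚ̄/ℚ(μ_p))` (`p ∤ p − 1`). No normalisation of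
the variable is involved: the `T`-variable of a dual datum at `γF` is `γF − 1`, whatever `χ_F(γF)` is.
[cite: Washington1997, §13.1] [cite: Kobayashi2003, §3 p. 5 (`G_∞ = Δ × Γ`)] -/
theorem exists_rat_frame_of_isTopGenerator {p : ℕ} [Fact p.Prime] (hp2 : p ≠ 2)
    (K₀ : Type) [Field K₀] [NumberField K₀] [IsCyclotomicExtension {p} ℚ K₀]
    (F : Type) [Field F] [NumberField F] (h2 : Module.finrank ℚ F = 2)
    {κF : ZpExtension F p} {γF : absoluteGaloisGroup F}
    (hκF : κF.IsCyclotomic) (hγF : κF.IsTopGenerator γF) :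
    ∃ (κ : ZpExtension ℚ p) (γ : absoluteGaloisGroup ℚ), κ.IsCyclotomic ∧ κ.IsTopGenerator γ ∧
      γ ∈ galRange (K := ℚ) K₀ ∧ γ⁻¹ * resGal (K := ℚ) F γF ∈ κ.kerSubgroup := by
  have hpP : p.Prime := Fact.out
  haveI : IsGalois ℚ F := isGalois_of_finrank_eq_two F h2
  have hcop : p.Coprime (Module.finrank ℚ F) := by
    rw [h2]; exact (Nat.coprime_primes hpP Nat.prime_two).mpr hp2
  have hκc : (CyclotomicZp.zpExtension p).IsCyclotomic := CyclotomicZp.isCyclotomic_zpExtension p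
  have hκ₀ : ∀ x, ∃ g ∈ galRange (K := ℚ) F, CyclotomicZp.zpExtension p g = x :=
    kappa_surjOn_galRange_of_coprime_finrank (CyclotomicZp.zpExtension p) F hcop
  obtain ⟨u, hu⟩ := ZpExtension.IsCyclotomic.exists_eq_unitTwist_holds
    (BaseChange.isCyclotomic_restrictGal F (CyclotomicZp.zpExtension p) hκ₀ hκc) hκF
  have hκ : ((CyclotomicZp.zpExtension p).unitTwist u).IsCyclotomic := by
    rw [ZpExtension.IsCyclotomic, ZpExtension.kerSubgroup_unitTwist]; exact hκc
  have hg' : ((CyclotomicZp.zpExtension p).unitTwist u).IsTopGenerator (resGal (K := ℚ) F γF) := by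
    have h := hγF
    rw [hu, ZpExtension.IsTopGenerator, ZpExtension.unitTwist_apply, BaseChange.restrictGal_apply] at h
    rw [ZpExtension.IsTopGenerator, ZpExtension.unitTwist_apply]
    exact h
  obtain ⟨γ, hγK, hγκ⟩ := kappa_surjOn_galRange_cyclotomic ((CyclotomicZp.zpExtension p).unitTwist u) K₀
    (((CyclotomicZp.zpExtension p).unitTwist u) (resGal (K := ℚ) F γF))
  refine ⟨(CyclotomicZp.zpExtension p).unitTwist u, γ, hκ, ?_, hγK, ?_⟩
  · rw [ZpExtension.IsTopGenerator, hγκ]; exact hg'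
  · rw [ZpExtension.mem_kerSubgroup, map_mul, map_inv, hγκ, inv_mul_cancel]

/-! ## §3 Dual data along the frame: `DF.X ≃ₗ[Λ] D.X × Dη.X` -/

/-- **Decomposition of dual data along a frame.** Given a decomposition `Φ : Sel⁺(V'/F_∞) ≃+ Sel⁺(V/ℚ_∞) × Sel⁺(V/K₀ℚ_∞)^η`
intertwining `conj_{γF}` with `conj_γ` (`γ ∈ Gal(ℚ̄/K₀)` a topological generator of `κ`), for EVERY dual datum `D` of
`Sel⁺(V/ℚ_∞)` at `γ` and `DF` of `Sel⁺(V'/F_∞)` at `γF` there is an `η`-component dual datum `Dη` at `γ` and a `Λ`-linear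
isomorphism `DF.X ≃ₗ[Λ] D.X × Dη.X`: the product datum on `D.X × Dη.X` (Pontryagin dual of a direct sum, `bijective_dualOfProd`)
is a dual datum of `Sel⁺(V'/F_∞)` at `γF`, and signed dual data are unique up to `Λ`-isomorphism
(`SignedSelmerDualData.exists_linearEquiv`). Seat k8q-c2's `exists_etaDatum_prod_linearEquiv_of_decomposition` with the frame
GIVEN at `(γ, γF)`. Pure transport. [cite: Kobayashi2003, Def. 1.1 (p. 2), Def. 2.1 (p. 5), §4 (p. 8)]
[cite: GreenbergLNM1716, §1 (p. 60), §3] -/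
theorem exists_etaDatum_prod_linearEquiv_of_frame {p : ℕ} [Fact p.Prime]
    {V : WeierstrassCurve ℚ} [V.IsElliptic]
    (K₀ : Type) [Field K₀] [NumberField K₀] [IsCyclotomicExtension {p} ℚ K₀]
    [(galRange (K := ℚ) K₀).Normal] (ηq : absoluteGaloisGroup ℚ →* ℤˣ)
    {κ : ZpExtension ℚ p} {γ : absoluteGaloisGroup ℚ} (hγ : κ.IsTopGenerator γ)
    (hγK : γ ∈ galRange (K := ℚ) K₀)
    {F : Type} [Field F] [NumberField F] {V' : WeierstrassCurve F} [V'.IsElliptic]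
    {κF : ZpExtension F p} {γF : absoluteGaloisGroup F}
    (Φ : Kobayashi2003.signedSelmerInfty V' κF 1 ≃+
        Kobayashi2003.signedSelmerInfty V κ 1 × towerSignedSelmerInftyEta V κ K₀ ℚ_[p] ηq 1)
    (hΦ : ∀ s : Kobayashi2003.signedSelmerInfty V' κF 1,
        ((Φ ⟨V'.conjH1 p κF.kerSubgroup γF s,
            Kobayashi2003.conjH1_mem_signedSelmerInfty V' κF 1 γF s.2⟩).1 : V.subgroupH1 p κ.kerSubgroup) =
          V.conjH1 p κ.kerSubgroup γ (Φ s).1 ∧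
        ((Φ ⟨V'.conjH1 p κF.kerSubgroup γF s,
            Kobayashi2003.conjH1_mem_signedSelmerInfty V' κF 1 γF s.2⟩).2 :
            V.subgroupH1 p (towerTopSubgroup κ K₀)) =
          V.conjH1 p (towerTopSubgroup κ K₀) γ (Φ s).2)
    (D : Kobayashi2003.SignedSelmerDualData V κ γ 1) (DF : Kobayashi2003.SignedSelmerDualData V' κF γF 1) :
    ∃ Dη : EtaSignedSelmerDualData V κ K₀ ℚ_[p] ηq γ 1, Nonempty (DF.X ≃ₗ[IwasawaAlgebra p] (D.X × Dη.X)) := by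
  -- adapted from seat k8q-c2's `exists_etaDatum_prod_linearEquiv_of_decomposition` (…PlusLowerInclusionUnitRows.lean §1)
  obtain ⟨Dη⟩ := nonempty_etaSignedSelmerDualData V κ K₀ ℚ_[p] ηq 1 (kappa_surjOn_galRange_cyclotomic κ K₀) hγ hγK
  -- the character group of the direct sum and the product datum at `γF`
  let π₀ : Kobayashi2003.signedSelmerInfty V' κF 1 →+ Kobayashi2003.signedSelmerInfty V κ 1 :=
    (AddMonoidHom.fst _ _).comp Φ.toAddMonoidHom
  let π₁ : Kobayashi2003.signedSelmerInfty V' κF 1 →+ towerSignedSelmerInftyEta V κ K₀ ℚ_[p] ηq 1 :=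
    (AddMonoidHom.snd _ _).comp Φ.toAddMonoidHom
  let T : D.X × Dη.X →+ (Kobayashi2003.signedSelmerInfty V' κF 1 →+ AddCircle (1 : ℚ)) :=
    AddMonoidHom.mk' (fun x => (D.toDual x.1).comp π₀ + (Dη.toDual x.2).comp π₁) (by
      intro x y
      simp only [Prod.fst_add, Prod.snd_add, map_add, AddMonoidHom.add_comp]
      abel)
  have hT : ∀ (x : D.X × Dη.X) (s : Kobayashi2003.signedSelmerInfty V' κF 1),
      T x s = D.toDual x.1 (Φ s).1 + Dη.toDual x.2 (Φ s).2 := fun x s => rfl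
  have hTbij : Function.Bijective T :=
    bijective_dualOfProd Φ D.toDual Dη.toDual D.bijective Dη.bijective
  let DF' : Kobayashi2003.SignedSelmerDualData V' κF γF 1 :=
    { X := D.X × Dη.X
      conj_mem := fun s hs => Kobayashi2003.conjH1_mem_signedSelmerInfty V' κF 1 γF hs
      toDual := T
      bijective := hTbij
      toDual_T_smul := by
        intro x s
        have h0 : (Φ ⟨V'.conjH1 p κF.kerSubgroup γF s,
            Kobayashi2003.conjH1_mem_signedSelmerInfty V' κF 1 γF s.2⟩).1 =
            ⟨V.conjH1 p κ.kerSubgroup γ (Φ s).1, D.conj_mem _ (Φ s).1.2⟩ :=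
          Subtype.ext (hΦ s).1
        have h1 : (Φ ⟨V'.conjH1 p κF.kerSubgroup γF s,
            Kobayashi2003.conjH1_mem_signedSelmerInfty V' κF 1 γF s.2⟩).2 =
            ⟨V.conjH1 p (towerTopSubgroup κ K₀) γ (Φ s).2, Dη.conj_mem _ (Φ s).2.2⟩ :=
          Subtype.ext (hΦ s).2
        rw [hT, hT, hT, Prod.smul_fst, Prod.smul_snd, D.toDual_T_smul, Dη.toDual_T_smul, h0, h1]
        abel
      toDual_C_smul := by
        intro c x s k hk
        have hk' : (p ^ k) • Φ s = 0 := by rw [← map_nsmul, hk, map_zero]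
        have hk0 : (p ^ k) • (Φ s).1 = 0 := by
          have h := congrArg Prod.fst hk'
          rwa [Prod.smul_fst, Prod.fst_zero] at h
        have hk1 : (p ^ k) • (Φ s).2 = 0 := by
          have h := congrArg Prod.snd hk'
          rwa [Prod.smul_snd, Prod.snd_zero] at h
        rw [hT, hT, Prod.smul_fst, Prod.smul_snd, D.toDual_C_smul c x.1 _ k hk0,
          Dη.toDual_C_smul c x.2 _ k hk1, smul_add] }
  -- uniqueness of signed dual data
  obtain ⟨e, -⟩ := Kobayashi2003.SignedSelmerDualData.exists_linearEquiv DF DF'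
  exact ⟨Dη, ⟨e⟩⟩

/-! ## §4 The `DF`-half: `Char X⁺(V'/F_∞)` is `ι`-invariant, by name from Kim 3.12 + 3.11 and Kobayashi 1.2 + 2.2 -/

/-- **The `DF`-half of item 26766, BY NAME.** Granted the named facts `h12` (Kobayashi Thm. 1.2), `h22` (Kobayashi Thm. 2.2 at
`η`), `h312` (Kim Thm. 3.12 at `K = ℚ`) and `h311` (Kim Thm. 3.11 on the `{±1}`-valued `η`-components), for `V/ℚ` globally
minimal, `p ≥ 5` good with `a_p = 0`, a quadratic `F ∋ θ` with `θ² = p*`, a model `V' = C • V_F`, a CYCLOTOMIC `κF` over `F`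
with ANY topological generator `γF`, and ANY dual datum `DF` of `Sel⁺(V'/F_∞)` at `γF`:
`DF.charIdeal.map ι = DF.charIdeal`. Proof: §2 gives a matching cyclotomic `(κ, γ)` over `ℚ` (`γ ∈ Gal(ℚ̄/ℚ(ζ_p))`,
`γ⁻¹·γF| ∈ ker κ`), §1 the decomposition frame at `(K₀, η_F) = (ℚ(ζ_p), χ_{p*})`, §3 `DF.X ≃ₗ D.X × Dη.X`; `Char` is
multiplicative on finitely generated torsion modules (`h12` for `D`, `h22` for `Dη`), so
`Char DF = Char D · Char Dη`, and both factors are `ι`-invariant (`h312` on `D`, `h311` on the `η_F`-component `Dη`;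
`ι` is a ring map, `Ideal.map_mul`). The prime-to-`p` descent is the kernel's, not an input.
[cite: KimBD2008MRL, Thm. 3.11 and Thm. 3.12 (p. 93), p. 84 (η-decomposition)] [cite: Kobayashi2003, Thm. 1.2 (p. 2),
Thm. 2.2 (p. 5), §4 (p. 8)] [cite: GreenbergLNM1716, §3 (descent; reading)] [cite: Washington1997, §13.2] -/
theorem charIdeal_map_invol_eq_DF_of_namedFacts {p : ℕ} [Fact p.Prime]
    (h12 : Kobayashi2003.thm12_signedSelmerDual_finite_torsion)
    (h22 : Kobayashi2003.thm22_etaSignedSelmerDual_finite_torsion)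
    (h312 : Kim2008.thm312_signedSelmerDual_charIdeal_map_invol)
    (h311 : Kim2008.thm311_etaSignedSelmerDual_charIdeal_map_invol)
    (V : WeierstrassCurve ℚ) [V.IsElliptic] [V.IsGloballyMinimal] (hp5 : 5 ≤ p)
    (hgood : V.HasGoodReductionAtPrime p) (hap : V.frobeniusTrace p = 0)
    (F : Type) [Field F] [NumberField F] (V' : WeierstrassCurve F) [V'.IsElliptic]
    {κF : ZpExtension F p} {γF : absoluteGaloisGroup F}
    (hF : Module.finrank ℚ F = 2) (hθ : ∃ θ : F, θ ^ 2 = algebraMap ℚ F ((-1) ^ (p / 2) * p))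
    (hC : ∃ C : VariableChange F, C • V.baseChange F = V')
    (hκF : κF.IsCyclotomic) (hγF : κF.IsTopGenerator γF)
    (DF : Kobayashi2003.SignedSelmerDualData V' κF γF 1) :
    DF.charIdeal.map (IwasawaAlgebra.invol p) = DF.charIdeal := by
  have hp2 : p ≠ 2 := by omega
  have hp3 : 3 < p := by omega
  haveI : NeZero p := ⟨(Fact.out : p.Prime).ne_zero⟩
  haveI : IsCyclotomicExtension {p} ℚ (CyclotomicField p ℚ) :=
    CyclotomicField.isCyclotomicExtension p ℚ
  haveI : (galRange (K := ℚ) (CyclotomicField p ℚ)).Normal := normal_galRange_cyclotomic p _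
  obtain ⟨θ, ηq, -, -, -, hηK, hη1⟩ := exists_theta_eta_cyclotomicField p hp2
  -- a cyclotomic `(κ, γ)` over `ℚ` matching `γF`
  obtain ⟨κ, γ, hκ, hγ, hγK, hδ⟩ :=
    exists_rat_frame_of_isTopGenerator hp2 (CyclotomicField p ℚ) F hF hκF hγF
  -- the decomposition frame and the decomposition of dual data
  obtain ⟨Φ, hΦ⟩ := etaDescentFrame_of_inv_mul_resGal_mem p hp5 (CyclotomicField p ℚ) ηq hηK hη1 V hgood
    hap κ γ hκ hγ hγK F V' κF γF hF hθ hC hκF hγF hδ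
  obtain ⟨D⟩ := Kobayashi2003.nonempty_signedSelmerDualData V κ 1 hγ
  obtain ⟨Dη, ⟨e⟩⟩ := exists_etaDatum_prod_linearEquiv_of_frame (CyclotomicField p ℚ) ηq hγ hγK Φ hΦ D DF
  -- finiteness and torsion: Thm. 1.2 for `D`, Thm. 2.2 at `η` for `Dη`
  obtain ⟨hDfin, hDtor⟩ := h12 V p hp2 hgood hap κ γ hκ hγ 1 D
  obtain ⟨hηfin, hηtor⟩ :=
    EtaSignedSelmerDualData.finite_isTorsion_of_thm22 h22 hηK hp2 hgood hap hκ hγ hγK Dη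
  haveI : Module.Finite (IwasawaAlgebra p) D.X := hDfin
  haveI : Module.Finite (IwasawaAlgebra p) Dη.X := hηfin
  have hPtor : Module.IsTorsion (IwasawaAlgebra p) (D.X × Dη.X) :=
    isTorsion_prod_of_isTorsion hDtor hηtor
  have hPchar : Module.charIdeal (IwasawaAlgebra p) (D.X × Dη.X) =
      Module.charIdeal (IwasawaAlgebra p) D.X * Module.charIdeal (IwasawaAlgebra p) Dη.X :=
    charIdeal_mul_of_shortExact_holds p (D.X × Dη.X) hPtor
      (LinearMap.inl (IwasawaAlgebra p) D.X Dη.X) (LinearMap.snd (IwasawaAlgebra p) D.X Dη.X)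
      LinearMap.inl_injective LinearMap.snd_surjective .inl_snd
  have hcharF : DF.charIdeal = D.charIdeal * Dη.charIdeal := by
    change Module.charIdeal (IwasawaAlgebra p) DF.X =
      Module.charIdeal (IwasawaAlgebra p) D.X * Module.charIdeal (IwasawaAlgebra p) Dη.X
    rw [Module.charIdeal_eq_of_linearEquiv e]
    exact hPchar
  -- Kim: both factors are `ι`-invariant
  have hD : D.charIdeal.map (IwasawaAlgebra.invol p) = D.charIdeal :=
    h312 V p hp3 hgood hap κ γ hκ hγ 1 D
  have hη : Dη.charIdeal.map (IwasawaAlgebra.invol p) = Dη.charIdeal := by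
    rw [← Dη.charIdeal_toLiterature]
    exact h311 p (CyclotomicField p ℚ) ηq hηK V hp3 hgood hap κ γ hκ hγ hγK 1 Dη.toLiterature
  rw [hcharF, Ideal.map_mul, hD, hη]

/-! ## §5 The item's statement, by name -/

/-- **K8 support item `PlusSignedDualsInvolInvariant` (stmt-BirchSwinnertonDyer-26766), BY NAME from four print-exact
named Literature facts** — `Kobayashi2003.thm12_signedSelmerDual_finite_torsion` (Thm. 1.2),
`Kobayashi2003.thm22_etaSignedSelmerDual_finite_torsion` (Thm. 2.2 at `η`), `Kim2008.thm312_signedSelmerDual_charIdeal_map_invol`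
(Kim Thm. 3.12 at `K = ℚ`), `Kim2008.thm311_etaSignedSelmerDual_charIdeal_map_invol` (Kim Thm. 3.11, `η² = 1` components):
on the K8 rows both plus characteristic ideals, `Char X⁺(V/ℚ_∞)` (datum `D` at `γ`) and `Char X⁺(V'/F_∞)` (datum `DF` at `γF`),
are fixed by the Iwasawa involution. Conclusion = the route decl VERBATIM (glue-ready). `D`-half: Kim 3.12 by name
(`….plus_of_five_le`); `DF`-half: §4 (prime-to-`p` descent in the kernel). CONDITIONAL on the four facts; closes nothing by
itself; proves BSD for no curve. [cite: KimBD2008MRL, Thm. 3.11, Thm. 3.12 (p. 93), eq. (1) p. 83]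
[cite: Kobayashi2003, Thm. 1.2 (p. 2), Thm. 2.2 (p. 5), §4 (p. 8)] [cite: GreenbergLNM1716, §3] -/
theorem plusSignedDualsInvolInvariant_of_namedFacts
    (h12 : Kobayashi2003.thm12_signedSelmerDual_finite_torsion)
    (h22 : Kobayashi2003.thm22_etaSignedSelmerDual_finite_torsion)
    (h312 : Kim2008.thm312_signedSelmerDual_charIdeal_map_invol)
    (h311 : Kim2008.thm311_etaSignedSelmerDual_charIdeal_map_invol) :
    Summit.BirchSwinnertonDyer.BirchSwinnertonDyer.Theses.QuadraticBranchSignedControl.PlusSignedDualsInvolInvariant := by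
  unfold Theses.QuadraticBranchSignedControl.PlusSignedDualsInvolInvariant
  intro V _ _ p _ hp5 hgood hap F _ _ V' _ κ γ κF γF hF hθ hC hκ hγ hκF hγF D DF
  exact ⟨Kim2008.thm312_signedSelmerDual_charIdeal_map_invol.plus_of_five_le h312 V p hp5 hgood hap κ γ hκ hγ D,
    charIdeal_map_invol_eq_DF_of_namedFacts h12 h22 h312 h311 V hp5 hgood hap F V' hF hθ hC hκF hγF DF⟩

/-! ## §6 The LITERAL crux 20445 `PlusKatoDivisibilityBranchOnto` from print-exact named facts only -/

/-- **The literal K8 crux `PlusKatoDivisibilityBranchOnto` (item 20445, (RK⁺) on the tower-onto Gss2 rows) from SIX print-exact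
named Literature facts and nothing else**: `h12` (Kobayashi Thm. 1.2), `hZ′`
(`Kobayashi2003.thm62_63_73_etaColemanPoitouTate_zeta_contra`, p608027), `Q73′`
(`Kato2004.thm13_4_lengthAt_fineSelmerDualContra_le_of_isEulerSystemClass`, p600084), `h22` (Kobayashi Thm. 2.2 at `η`), `h312`,
`h311` (Kim 2008 Thm. 3.12 / 3.11, p615855) — through the CLOSED gen-2 child `plusKatoDivisibilityBranchOntoIotaOfNamedInputs_proof`
(p614428: the `ι`-form (RK⁺)^ι from `{h12, hZ′, Q73′}`), §5 (child 2 from `{h12, h22, h312, h311}`) and the CLOSED glue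
`plusKatoDivisibilityBranchOntoOfIotaOfInvolInvariant_proof` (p614470; the alias children 3–5 unfold definitionally). No
`ι`-symmetry hypothesis, no functional equation of `L_p⁺(V, η, X)`, no unprinted statement. CONDITIONAL; BSD for no curve.
[cite: KimBD2008MRL, Thm. 3.11, Thm. 3.12 (p. 93)] [cite: Kobayashi2003, Thm. 1.2, 2.2, 4.1, 6.2–6.3, Cor. 7.2, Thm. 7.3 i)]
[cite: Kato2004Asterisque, Thm. 13.4 (p. 226), (12.5.2) (p. 222)] -/
theorem plusKatoDivisibilityBranchOnto_of_printNamedFacts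
    (h12 : Kobayashi2003.thm12_signedSelmerDual_finite_torsion)
    (hZc : Kobayashi2003.thm62_63_73_etaColemanPoitouTate_zeta_contra)
    (h134c : Kato2004.thm13_4_lengthAt_fineSelmerDualContra_le_of_isEulerSystemClass)
    (h22 : Kobayashi2003.thm22_etaSignedSelmerDual_finite_torsion)
    (h312 : Kim2008.thm312_signedSelmerDual_charIdeal_map_invol)
    (h311 : Kim2008.thm311_etaSignedSelmerDual_charIdeal_map_invol) :
    Summit.BirchSwinnertonDyer.BirchSwinnertonDyer.Theses.QuadraticBranchSignedControl.PlusKatoDivisibilityBranchOnto :=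
  plusKatoDivisibilityBranchOntoOfIotaOfInvolInvariant_proof plusKatoDivisibilityBranchOntoIotaOfNamedInputs_proof
    (plusSignedDualsInvolInvariant_of_namedFacts h12 h22 h312 h311) h12 hZc h134c

end SignedDualsInvol

end Summit.BirchSwinnertonDyer.BirchSwinnertonDyer.Theorems

end
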